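import Literature.NumberTheory.Sieve.QuadraticRootsTothColumnSum
import Literature.NumberTheory.Sieve.PolynomialCongruencesProofs
import Literature.NumberTheory.LFunctions.KloostermanWeilPrimeProofs
import Literature.NumberTheory.Sieve.QuadraticRootsPrimeModuliDFIDivisorSums
import Mathlib.Analysis.Fourier.ZMod
import HarnessLib

/-!
# The zero frequency of the Poisson-dual Tóth sums: restricted Ramanujan–Kloosterman sums

Topic `Literature/NumberTheory/Sieve`, continuation of `QuadraticRootsTothColumnSum.lean`.  There
the Tóth sum of `toth2000_quadraticRoots_primeModuli` was brought to the dual form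
`T = ∑_{0<|α|≤A} M_α⁻¹ ∑_{κ∈ℤ} 𝓕(colFn(α,·))(κ/M_α) · S_α(h,κ)` (`tothSum_eq_dualSum`, T. Ngo,
arXiv:2107.13301, §3.5 Lemma 3.15), `M_α = |α|·a·d`, with the complete sums
`S_α(h,κ) = colExpSum a d R h α κ = ∑_{r mod M_α, (α,r)=1, a∣r, ad∣A'(α,r)} e(−h r̄/α + rκ/M_α)`.
Ngo's Proposition 3.18 then feeds the `κ ≠ 0` part into Pitt's bound for sums of Kloosterman
sums (Theorem 2.5, stated for `K < κ < 2K`); the zero frequency `κ = 0` — a sum of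
Ramanujan/Kloosterman sums restricted by the level condition — is not discussed in the paper and is
disposed of here, elementarily and uniformly in `h` and `d`:

* `colExpSum_zero_eq` — `S_α(h,0) = ∑_{s mod |α|d, (s,α)=1, d ∣ F_α(s)} ψ_{|α|}(c·s̄)` with the
  column polynomial `F_α(s) = (Ca)s² + (Bα)s + (A/a)α²` (`colPoly`; `A'(α, as) = a·F_α(s)`) and
  `c = −h·sgn(α)·ā`;
* `norm_sum_shift_le` — for any `Φ : ℤ/n → ℂ`, `|∑_i Φ(s + e i)| ≤ #{k : ke = 0} · max_k |Φ̂(k)|`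
  (finite Fourier inversion on `ℤ/n`, Mathlib's `ZMod.dft`), `#{k : ke = 0} ≤ (e, n)` (the tree's
  `card_filter_intCast_mul_eq_zero_le`), and for
  `Φ(y) = [y unit] ψ(c ȳ)` the Fourier coefficients are Kloosterman sums `S(−k, c; n)`, bounded by
  the tree's PROVED Weil bound `weil_kloosterman_bound_holds`; whence
  `|S_α(h,0)| ≤ ρ_{F_α}(d) · (|α|, d) · τ(|α|) |α|^{1/2} (h, α)^{1/2}` (`norm_colExpSum_zero_le_rho`);
* `colExpSum_zero_eq_zero_of_not_dvd` — if `(|α|, d) ∤ Ca` the column is EMPTY (`S_α(h, ·)`'s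
  coefficients all vanish: some `p^{w+1} ∣ (α, d)` with `p^w ∥ Ca`, and then `p^{w+1} ∤ F_α(s)` for
  `p ∤ s`); otherwise `(|α|, d) ≤ |Ca|` and `ρ_{F_α}(d) ≤ 2^{ω(d)} (Ca)⁴Δ²` uniformly in `α`
  (`rho_colPoly_le`: Hardy–Wright multiplicativity and the tree's Nagell/Hensel bound
  `polyRootCountMod_prime_pow_le_of_resultant` with `4(Ca)F_α − (2(Ca)X + Bα)F_α' = −α²Δ`);
* **`norm_colExpSum_zero_le`** — `|S_α(h,0)| ≤ C_R τ(d) τ(|α|) |α|^{1/2} (h,α)^{1/2}` for all `α ≠ 0`;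
* **`exists_dualZero_bound`** — the zero-frequency part of the dual sum is
  `≪_{R,ε} x^{3/4} d^{-1/2} (xd)^ε`, uniformly in `0 < |h| ≤ C_h x` (via
  `∑_{n ≤ X} τ(n)(h,n)^{1/2} n^{-1/2} ≪ τ(h) X^{1/2} log X`, the tree's
  `DFI1995.sum_tau_sqrt_gcd_div_sqrt_le`), i.e. within the first term of Ngo's Proposition 3.18.

## References

* T. Ngo, *On roots of quadratic congruences*, arXiv:2107.13301 (Bull. LMS 2024), §3.5
  Lemma 3.15, Proposition 3.18, §2.2 Theorem 2.5. [cite: Ngo2024, §3.5 Proposition 3.18]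
* Á. Tóth, *Roots of quadratic congruences*, IMRN 2000, 719–739. [cite: Toth2000, §4]
* H. Iwaniec, *Spectral Methods of Automorphic Forms*, (2.25) (Weil's bound). [cite: Iwaniec2002, §2.5 (2.25)]
-/

noncomputable section

namespace Literature.NumberTheory.Sieve

open scoped MatrixGroups
open Literature.NumberTheory.QuadraticFields.Quadratic (BinQF)
open Literature.NumberTheory.LFunctions
open Polynomial Finset

namespace RootForms

/-! ### Finite Fourier analysis on `ℤ/n`: shifted sums along a progression -/

section zmod

variable {n : ℕ} [NeZero n]

/-- **Shifted sums along a progression through the finite Fourier transform**: for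
`Φ : ℤ/n → ℂ` and `s, e ∈ ℤ/n`, `∑_i Φ(s + e i) = ∑_{k : ke = 0} Φ̂(k) ψ(ks) / 1`, where
`Φ̂ = ZMod.dft Φ` (`Φ̂(k) = ∑_j ψ(−jk) Φ(j)`) — Fourier inversion and orthogonality
`∑_i ψ(i·ke) = n·[ke = 0]`. [folklore] -/
theorem sum_shift_mul_eq_sum_dft (Φ : ZMod n → ℂ) (s e : ZMod n) :
    ∑ i : ZMod n, Φ (s + e * i) =
      ∑ k ∈ univ.filter (fun k : ZMod n => k * e = 0), ZMod.dft Φ k * ZMod.stdAddChar (k * s) := by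
  classical
  -- Fourier inversion
  have hinv : ∀ y : ZMod n, Φ y = (n : ℂ)⁻¹ * ∑ k : ZMod n, ZMod.stdAddChar (k * y) * ZMod.dft Φ k := by
    intro y
    have h := ZMod.invDFT_apply (ZMod.dft Φ) y
    rw [LinearEquiv.symm_apply_apply] at h
    rw [h, smul_eq_mul]
    simp only [smul_eq_mul]
  simp_rw [hinv]
  rw [← Finset.mul_sum, Finset.sum_comm]
  have hn0 : (n : ℂ) ≠ 0 := by exact_mod_cast NeZero.ne n
  -- orthogonality in `i`
  have horth : ∀ k : ZMod n, ∑ i : ZMod n, ZMod.stdAddChar (k * (s + e * i)) * ZMod.dft Φ k =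
      ZMod.dft Φ k * ZMod.stdAddChar (k * s) * (if k * e = 0 then (n : ℂ) else 0) := by
    intro k
    have h1 : ∀ i : ZMod n, ZMod.stdAddChar (k * (s + e * i)) =
        ZMod.stdAddChar (k * s) * ZMod.stdAddChar (i * (k * e)) := by
      intro i
      rw [← AddChar.map_add_eq_mul]; congr 1; ring
    simp_rw [h1]
    rw [← Finset.sum_mul, ← Finset.mul_sum,
      AddChar.sum_mulShift (k * e) (ZMod.isPrimitive_stdAddChar n), ZMod.card, Nat.cast_ite,
      Nat.cast_zero]
    ring
  simp_rw [horth]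
  rw [Finset.mul_sum, Finset.sum_filter]
  refine Finset.sum_congr rfl fun k _ => ?_
  split_ifs with hk
  · field_simp
  · simp

/-- Consequently `|∑_i Φ(s + e i)| ≤ (e, n) · B` whenever `|Φ̂(k)| ≤ B` for all `k`. [folklore] -/
theorem norm_sum_shift_le {Φ : ZMod n → ℂ} {B : ℝ} (hB : ∀ k, ‖ZMod.dft Φ k‖ ≤ B) (s : ZMod n)
    (e : ℕ) :
    ‖∑ i : ZMod n, Φ (s + (e : ZMod n) * i)‖ ≤ Nat.gcd e n * B := by
  classical
  rw [sum_shift_mul_eq_sum_dft]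
  have hB0 : 0 ≤ B := (norm_nonneg _).trans (hB 0)
  refine (norm_sum_le _ _).trans ?_
  calc ∑ k ∈ univ.filter (fun k : ZMod n => k * (e : ZMod n) = 0),
        ‖ZMod.dft Φ k * ZMod.stdAddChar (k * s)‖
      ≤ ∑ _k ∈ univ.filter (fun k : ZMod n => k * (e : ZMod n) = 0), B := by
        refine Finset.sum_le_sum fun k _ => ?_
        rw [norm_mul, ZMod.stdAddChar_apply, Circle.norm_coe, mul_one]
        exact hB k
    _ = #(univ.filter (fun k : ZMod n => k * (e : ZMod n) = 0)) * B := by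
        rw [Finset.sum_const, nsmul_eq_mul]
    _ ≤ Nat.gcd e n * B := by
        refine mul_le_mul_of_nonneg_right ?_ hB0
        have h1 : univ.filter (fun k : ZMod n => k * (e : ZMod n) = 0) =
            univ.filter (fun k : ZMod n => ((e : ℤ) : ZMod n) * k = 0) := by
          refine Finset.filter_congr fun k _ => ?_
          rw [Int.cast_natCast, mul_comm]
        have h2 := card_filter_intCast_mul_eq_zero_le (d := n) (e : ℤ)
        rw [Int.gcd_natCast_natCast] at h2
        rw [h1]
        exact_mod_cast h2

/-- The function `y ↦ [y unit] ψ_n(c ȳ)` on `ℤ/n`. [folklore] -/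
def invPhase (n : ℕ) [NeZero n] (c : ZMod n) (y : ZMod n) : ℂ :=
  by classical exact if IsUnit y then (ZMod.stdAddChar (c * y⁻¹) : ℂ) else 0

/-- `‖invPhase‖ ≤ 1`. [folklore] -/
theorem norm_invPhase_le (c y : ZMod n) : ‖invPhase n c y‖ ≤ 1 := by
  unfold invPhase
  split_ifs
  · rw [ZMod.stdAddChar_apply, Circle.norm_coe]
  · simp

/-- **The finite Fourier transform of `invPhase` is a Kloosterman sum**:
`∑_j ψ(−jk) [j unit] ψ(c j̄) = S(−k, c; n)`. [cite: Iwaniec2002, §2.5 (2.23)] -/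
theorem dft_invPhase (c k : ZMod n) : ZMod.dft (invPhase n c) k = kloostermanSum n (-k) c := by
  classical
  rw [ZMod.dft_apply]
  unfold kloostermanSum invPhase
  refine Finset.sum_congr rfl fun j _ => ?_
  simp only [smul_eq_mul]
  split_ifs with hj
  · rw [← AddChar.map_add_eq_mul]; congr 1; ring
  · rw [mul_zero]

/-- **Weil's bound for the Fourier coefficients of `invPhase`**: for `c = m·w (mod n)` with
`(w, n) = 1`, `|S(−k, c; n)| ≤ τ(n) n^{1/2} (m, n)^{1/2}` (the tree's PROVED
`weil_kloosterman_bound_holds`, and `(k, c, n) ∣ (c, n) = (m, n)`). [cite: Iwaniec2002, §2.5 (2.25)] -/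
theorem norm_dft_invPhase_le {m : ℤ} {w : ℕ} (hw : Nat.Coprime w n) (k : ZMod n) :
    ‖ZMod.dft (invPhase n ((m * w : ℤ) : ZMod n)) k‖ ≤
      (#n.divisors : ℝ) * Real.sqrt n * Real.sqrt (Int.gcd m n) := by
  rw [dft_invPhase]
  have hk : (-k : ZMod n) = ((-(k.val : ℤ) : ℤ) : ZMod n) := by
    push_cast; rw [ZMod.natCast_zmod_val]
  rw [hk]
  have hW := weil_kloosterman_bound_holds n (-(k.val : ℤ)) (m * w)
  refine hW.trans ?_
  have hgcd : (Nat.gcd (Nat.gcd (-(k.val : ℤ)).natAbs (m * (w : ℤ)).natAbs) n : ℝ) ≤ Int.gcd m n := by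
    have h1 : Nat.gcd (Nat.gcd (-(k.val : ℤ)).natAbs (m * (w : ℤ)).natAbs) n ∣
        Nat.gcd (m * (w : ℤ)).natAbs n := Nat.gcd_dvd_gcd_of_dvd_left n (Nat.gcd_dvd_right _ _)
    have h2 : Nat.gcd (m * (w : ℤ)).natAbs n = Int.gcd m n := by
      rw [Int.natAbs_mul, Int.natAbs_natCast, Int.gcd_eq_natAbs, Int.natAbs_natCast]
      exact Nat.Coprime.gcd_mul_right_cancel _ hw
    rw [← h2]
    exact_mod_cast Nat.le_of_dvd (Nat.gcd_pos_of_pos_right _ (Nat.pos_of_ne_zero (NeZero.ne n))) h1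
  have hτ : (0 : ℝ) ≤ #n.divisors := Nat.cast_nonneg _
  calc Real.sqrt (Nat.gcd (Nat.gcd (-(k.val : ℤ)).natAbs (m * (w : ℤ)).natAbs) n) * Real.sqrt n *
        ((Nat.divisors n).card : ℝ)
      ≤ Real.sqrt (Int.gcd m n) * Real.sqrt n * ((Nat.divisors n).card : ℝ) := by
        gcongr
    _ = _ := by ring

end zmod

/-! ### The column polynomial and the complete sum at the zero frequency -/

section column

variable {R : BinQF} {a : ℤ}

/-- The column polynomial `F_α(s) = (Ca) s² + (Bα) s + (A/a) α²`, so that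
`A'(α, a s) = R.eval α (a s) = a · F_α(s)` when `a ∣ A`. [cite: Ngo2024, §3.5 Lemma 3.15] -/
def colPoly (R : BinQF) (a α : ℤ) : ℤ[X] :=
  C (R.c * a) * X ^ 2 + C (R.b * α) * X + C (R.a / a * α ^ 2)

/-- `F_α(s)` evaluated. [folklore] -/
theorem eval_colPoly (R : BinQF) (a α s : ℤ) :
    (colPoly R a α).eval s = R.c * a * s ^ 2 + R.b * α * s + R.a / a * α ^ 2 := by
  simp [colPoly]

/-- `A'(α, a s) = a F_α(s)` (`a ∣ A`). [folklore] -/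
theorem eval_mul_eq_mul_colPoly (hlev : a ∣ R.a) (α s : ℤ) :
    R.eval α (a * s) = a * (colPoly R a α).eval s := by
  rw [eval_colPoly, BinQF.eval]
  have h := Int.ediv_mul_cancel hlev
  linear_combination (-(α ^ 2 : ℤ)) * h

/-- `colCoef` vanishes off the multiples of `a`. [folklore] -/
theorem colCoef_eq_zero_of_not_dvd (d : ℕ) (h α : ℤ) {γ : ℤ} (hγ : ¬ a ∣ γ) :
    colCoef a d R h α γ = 0 := by
  unfold colCoef
  rw [if_neg]
  exact fun H => hγ H.2.1

/-- `colCoef` vanishes when `(α, a) > 1`. [folklore] -/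
theorem colCoef_mul_eq_zero_of_not_coprime (ha : 0 < a) (d : ℕ) (h : ℤ) {α : ℤ}
    (hcop : ¬ Nat.Coprime α.natAbs a.toNat) (s : ℕ) : colCoef a d R h α (a * s) = 0 := by
  unfold colCoef
  rw [if_neg]
  rintro ⟨H, -, -⟩
  apply hcop
  rw [Int.gcd_eq_natAbs, Int.natAbs_mul, Int.natAbs_natCast] at H
  have ha' : a.natAbs = a.toNat := by omega
  rw [← ha']
  exact Nat.Coprime.coprime_mul_right_right H

/-- **The zero frequency as a sum over `s < |α| d`**:
`S_α(h, 0) = ∑_{r mod M_α} colCoef(α, r) = ∑_{s < |α| d} colCoef(α, a s)` (`a ∣ r`).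
[cite: Ngo2024, §3.5 Lemma 3.15] -/
theorem colExpSum_zero_eq_sum_range (ha : 0 < a) (d : ℕ) (h α : ℤ) :
    colExpSum a d R h α 0 = ∑ s ∈ Finset.range (α.natAbs * d), colCoef a d R h α (a * s) := by
  unfold colExpSum
  simp only [Int.cast_zero, mul_zero, zero_div, AddChar.map_zero_eq_one, Circle.coe_one, mul_one]
  rw [Fin.sum_univ_eq_sum_range (fun r => colCoef a d R h α r) (α.natAbs * (a.toNat * d)),
    show α.natAbs * (a.toNat * d) = a.toNat * (α.natAbs * d) by ring,
    sum_range_mul_eq_sum_sum]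
  obtain ⟨a'', ha''⟩ : ∃ a'' : ℕ, a.toNat = a'' + 1 := Nat.exists_eq_succ_of_ne_zero (by omega)
  have hacast : ((a.toNat : ℕ) : ℤ) = a := Int.toNat_of_nonneg ha.le
  rw [ha'', Finset.sum_range_succ']
  have hzero : ∀ u ∈ Finset.range a'', ∑ v ∈ Finset.range (α.natAbs * d),
      colCoef a d R h α ((u + 1 + (a'' + 1) * v : ℕ) : ℤ) = 0 := by
    intro u hu
    rw [Finset.mem_range] at hu
    refine Finset.sum_eq_zero fun v _ => colCoef_eq_zero_of_not_dvd d h α fun H => ?_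
    rw [← ha''] at H
    push_cast at H
    rw [hacast] at H
    have H2 : a ∣ ((u + 1 : ℕ) : ℤ) := by
      have : a ∣ ((u : ℤ) + 1 + a * v) - a * v := dvd_sub H (dvd_mul_right a v)
      rw [add_sub_cancel_right] at this
      exact_mod_cast this
    have H3 := Int.le_of_dvd (by positivity) H2
    push_cast at H3
    omega
  rw [Finset.sum_eq_zero hzero, zero_add]
  refine Finset.sum_congr rfl fun v _ => ?_
  congr 1
  rw [← ha'']; push_cast; rw [hacast]; ring

variable {n : ℕ} [NeZero n]

/-- `e(k/n) = ψ_n(k)` for an integer `k` (Mathlib's `ZMod.stdAddChar_coe`). [folklore] -/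
theorem ex_intCast_div_natCast (k : ℤ) : ex ((k : ℝ) / n) = ZMod.stdAddChar ((k : ℤ) : ZMod n) := by
  rw [ZMod.stdAddChar_coe, ex]
  congr 1
  push_cast
  ring

/-- **The coefficient at `a s`**: for `(α, a) = 1`, `a ∣ A`, `|α| = n` and `a c₀ ≡ 1 (mod n)`,
`colCoef(α, a s) = [d ∣ F_α(s)] · [s unit mod n] ψ_n(−h·sgn(α)·c₀ · s̄)`.
[cite: Ngo2024, §3.5 Lemma 3.15, §3.2 Lemma 3.2] -/
theorem colCoef_mul_eq (ha : 0 < a) (hlev : a ∣ R.a) (d : ℕ) (h : ℤ) {α : ℤ} (hn : α.natAbs = n)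
    (hcop : Nat.Coprime n a.toNat) {c₀ : ZMod n} (hc₀ : (a : ZMod n) * c₀ = 1) (s : ℕ) :
    colCoef a d R h α (a * s) =
      if (d : ℤ) ∣ (colPoly R a α).eval (s : ℤ) then
        invPhase n (((-(h * α.sign) : ℤ) : ZMod n) * c₀) (s : ZMod n) else 0 := by
  classical
  have hα : α ≠ 0 := by rw [← Int.natAbs_ne_zero, hn]; exact NeZero.ne n
  have hacast : ((a.toNat : ℕ) : ℤ) = a := Int.toNat_of_nonneg ha.le
  -- the three conditions
  have hdiv_a : a ∣ a * (s : ℤ) := dvd_mul_right _ _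
  have hlev' : (((a.toNat * d : ℕ)) : ℤ) ∣ R.eval α (a * s) ↔ (d : ℤ) ∣ (colPoly R a α).eval (s : ℤ) := by
    rw [eval_mul_eq_mul_colPoly hlev]; push_cast; rw [hacast]
    exact mul_dvd_mul_iff_left ha.ne'
  have hunit : Int.gcd α (a * s) = 1 ↔ IsUnit ((s : ℕ) : ZMod n) := by
    rw [ZMod.isUnit_iff_coprime, Int.gcd_eq_natAbs, Int.natAbs_mul, Int.natAbs_natCast, hn]
    have ha' : a.natAbs = a.toNat := by omega
    rw [ha']
    change Nat.Coprime n (a.toNat * s) ↔ _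
    rw [Nat.coprime_mul_iff_right]
    exact ⟨fun H => H.2.symm, fun H => ⟨hcop, H.symm⟩⟩
  unfold colCoef invPhase
  by_cases hF : (d : ℤ) ∣ (colPoly R a α).eval (s : ℤ)
  · rw [if_pos hF]
    by_cases hu : IsUnit ((s : ℕ) : ZMod n)
    · rw [if_pos ⟨hunit.2 hu, hdiv_a, hlev'.2 hF⟩, if_pos hu]
      -- the phase
      set B₀ := Int.gcdB α (a * s) with hB₀
      have hbez : (1 : ZMod n) = (a : ZMod n) * (s : ZMod n) * (B₀ : ZMod n) := by
        have h1 := Int.gcd_eq_gcd_ab α (a * s)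
        rw [hunit.2 hu] at h1
        have h2 : ((α : ℤ) : ZMod n) = 0 := by
          rw [ZMod.intCast_zmod_eq_zero_iff_dvd, ← hn]
          exact Int.natAbs_dvd.2 dvd_rfl
        have h3 := congrArg (fun z : ℤ => (z : ZMod n)) h1
        push_cast at h3
        rw [h2, zero_mul, zero_add] at h3
        exact_mod_cast h3
      have hB₀' : (B₀ : ZMod n) = c₀ * ((s : ℕ) : ZMod n)⁻¹ := by
        have hsinv : ((s : ℕ) : ZMod n)⁻¹ * ((s : ℕ) : ZMod n) = 1 := ZMod.inv_mul_of_unit _ hu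
        calc (B₀ : ZMod n) = (c₀ * (a : ZMod n)) * ((((s : ℕ) : ZMod n)⁻¹ * ((s : ℕ) : ZMod n))) *
              (B₀ : ZMod n) := by rw [mul_comm c₀, hc₀, hsinv, one_mul, one_mul]
          _ = c₀ * ((s : ℕ) : ZMod n)⁻¹ * ((a : ZMod n) * (s : ZMod n) * (B₀ : ZMod n)) := by ring
          _ = c₀ * ((s : ℕ) : ZMod n)⁻¹ := by rw [← hbez, mul_one]
      -- `α = σ n`
      have hσ : α.sign * (n : ℤ) = α := by rw [← hn]; exact Int.sign_mul_natAbs α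
      have hphase : ex (h * ((-B₀ : ℤ) : ℝ) / α) = ex (((h * (-B₀) * α.sign : ℤ) : ℝ) / n) := by
        congr 1
        have hαr : (α : ℝ) = α.sign * n := by exact_mod_cast hσ.symm
        rw [div_eq_mul_inv, div_eq_mul_inv, hαr]
        push_cast
        rcases lt_or_gt_of_ne hα with hneg | hpos
        · rw [Int.sign_eq_neg_one_of_neg hneg]; push_cast; ring
        · rw [Int.sign_eq_one_of_pos hpos]; push_cast; ring
      rw [hphase, ex_intCast_div_natCast]
      congr 1
      push_cast
      rw [hB₀']; ring
    · rw [if_neg (fun H => hu (hunit.1 H.1)), if_neg hu]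
  · rw [if_neg hF, if_neg (fun H => hF (hlev'.1 H.2.2))]

/-- **Regrouping by `s mod d`**: with `F = F_α` and `Φ = invPhase n c`,
`∑_{s < n d} [d ∣ F(s)] Φ(s) = ∑_{s₂ < d} [d ∣ F(s₂)] ∑_{i ∈ ℤ/n} Φ(s₂ + d i)`. [folklore] -/
theorem sum_range_ite_dvd_eq (F : ℤ[X]) (d : ℕ) (Φ : ZMod n → ℂ) :
    ∑ s ∈ Finset.range (n * d), (if (d : ℤ) ∣ F.eval (s : ℤ) then Φ (s : ZMod n) else 0) =
      ∑ s₂ ∈ Finset.range d, if (d : ℤ) ∣ F.eval (s₂ : ℤ) then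
        ∑ i : ZMod n, Φ ((s₂ : ZMod n) + (d : ZMod n) * i) else 0 := by
  rw [mul_comm, sum_range_mul_eq_sum_sum]
  refine Finset.sum_congr rfl fun s₂ _ => ?_
  have hper : ∀ i : ℕ, ((d : ℤ) ∣ F.eval ((s₂ + d * i : ℕ) : ℤ)) ↔ (d : ℤ) ∣ F.eval (s₂ : ℤ) := by
    intro i
    have hsub : ((s₂ + d * i : ℕ) : ℤ) - (s₂ : ℤ) ∣ F.eval ((s₂ + d * i : ℕ) : ℤ) - F.eval (s₂ : ℤ) :=
      Polynomial.sub_dvd_eval_sub _ _ _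
    have hd : (d : ℤ) ∣ F.eval ((s₂ + d * i : ℕ) : ℤ) - F.eval (s₂ : ℤ) := by
      refine dvd_trans ⟨(i : ℤ), ?_⟩ hsub
      push_cast; ring
    exact (Int.dvd_iff_dvd_of_dvd_sub hd)
  by_cases hF : (d : ℤ) ∣ F.eval (s₂ : ℤ)
  · rw [if_pos hF, sum_zmod_eq_sum_range]
    refine Finset.sum_congr rfl fun i _ => ?_
    rw [if_pos ((hper i).2 hF)]
    push_cast; ring_nf
  · rw [if_neg hF]
    refine Finset.sum_eq_zero fun i _ => ?_
    rw [if_neg (fun H => hF ((hper i).1 H))]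

/-- `ρ_F(d)` as the count of `s < d` with `d ∣ F(s)`. [folklore] -/
theorem polyRootCountMod_single (F : ℤ[X]) (d : ℕ) :
    polyRootCountMod ![F] d = #((Finset.range d).filter fun s : ℕ => (d : ℤ) ∣ F.eval (s : ℤ)) := by
  simp [polyRootCountMod]

/-- **Bound through the root count**: if `|∑_i Φ(s₂ + d i)| ≤ B` for every `s₂`, then
`|∑_{s<nd} [d ∣ F(s)] Φ(s)| ≤ ρ_F(d) · B`. [folklore] -/
theorem norm_sum_range_ite_dvd_le (F : ℤ[X]) (d : ℕ) (Φ : ZMod n → ℂ) {B : ℝ}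
    (hB : ∀ s₂ : ℕ, ‖∑ i : ZMod n, Φ ((s₂ : ZMod n) + (d : ZMod n) * i)‖ ≤ B) :
    ‖∑ s ∈ Finset.range (n * d), (if (d : ℤ) ∣ F.eval (s : ℤ) then Φ (s : ZMod n) else 0)‖ ≤
      polyRootCountMod ![F] d * B := by
  rw [sum_range_ite_dvd_eq, polyRootCountMod_single]
  refine (norm_sum_le _ _).trans ?_
  calc ∑ s₂ ∈ Finset.range d, ‖if (d : ℤ) ∣ F.eval (s₂ : ℤ) then
          ∑ i : ZMod n, Φ ((s₂ : ZMod n) + (d : ZMod n) * i) else 0‖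
      ≤ ∑ s₂ ∈ Finset.range d, (if (d : ℤ) ∣ F.eval (s₂ : ℤ) then B else 0) := by
        refine Finset.sum_le_sum fun s₂ _ => ?_
        split_ifs
        · exact hB s₂
        · rw [norm_zero]
    _ = #((Finset.range d).filter fun s : ℕ => (d : ℤ) ∣ F.eval (s : ℤ)) * B := by
        rw [← Finset.sum_filter, Finset.sum_const, nsmul_eq_mul]

/-! ### Empty columns and the uniform root-count bound -/

/-- **Empty columns.**  If `(n, d) ∤ Ca` then for `s` a unit mod `n`, `d ∤ F_α(s)`: there is a prime
`p` with `p^{w+1} ∣ (n, d)`, `p^w ∥ Ca`; then `p^{w+1}` divides `(Bα)s + (A/a)α²` but not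
`(Ca)s²` (`p ∤ s`).  (Ngo: the Kloosterman moduli at the cusp `μ/ν` are `ν·c` with `(c, N') = 1`,
Lemma 2.4 (2).) [cite: Ngo2024, §2.1 Lemma 2.4] -/
theorem not_dvd_colPoly_of_not_dvd (ha : a ≠ 0) (hc : R.c ≠ 0) {α : ℤ} (hn : α.natAbs = n)
    {d : ℕ} (hd : d ≠ 0) (hnd : ¬ Nat.gcd n d ∣ (R.c * a).natAbs) {s : ℕ} (hs : Nat.Coprime s n) :
    ¬ (d : ℤ) ∣ (colPoly R a α).eval (s : ℤ) := by
  set m := (R.c * a).natAbs with hm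
  have hm0 : m ≠ 0 := Int.natAbs_ne_zero.2 (mul_ne_zero hc ha)
  have hn0 : n ≠ 0 := NeZero.ne n
  set g := Nat.gcd n d with hg
  have hg0 : g ≠ 0 := Nat.gcd_ne_zero_right hd
  -- a prime with `v_p(g) > v_p(m)`
  obtain ⟨p, hp⟩ : ∃ p : ℕ, m.factorization p < g.factorization p := by
    by_contra H
    push Not at H
    exact hnd ((Nat.factorization_le_iff_dvd hg0 hm0).1 (Finsupp.le_def.2 H))
  have hpp : p.Prime := by
    have : p ∈ g.factorization.support := Finsupp.mem_support_iff.2 (by omega)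
    rw [Nat.support_factorization] at this
    exact Nat.prime_of_mem_primeFactors this
  set w := m.factorization p with hw
  have hpg : p ^ (w + 1) ∣ g := (hpp.pow_dvd_iff_le_factorization hg0).2 (by omega)
  have hpn : p ^ (w + 1) ∣ n := hpg.trans (Nat.gcd_dvd_left n d)
  have hpd : p ^ (w + 1) ∣ d := hpg.trans (Nat.gcd_dvd_right n d)
  have hpm : ¬ p ^ (w + 1) ∣ m := Nat.pow_succ_factorization_not_dvd hm0 hpp
  intro hF
  apply hpm
  -- `P = p^{w+1}` divides `F(s)`, `α`, hence `(Ca) s²`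
  set P : ℤ := ((p ^ (w + 1) : ℕ) : ℤ) with hP
  have hPF : P ∣ (colPoly R a α).eval (s : ℤ) := (Int.natCast_dvd_natCast.2 hpd).trans hF
  have hPα : P ∣ α := by rw [hP, Int.natCast_dvd, hn]; exact hpn
  rw [eval_colPoly] at hPF
  have hPc : P ∣ R.c * a * (s : ℤ) ^ 2 := by
    have h1 : P ∣ R.b * α * s + R.a / a * α ^ 2 :=
      dvd_add (dvd_mul_of_dvd_left (dvd_mul_of_dvd_right hPα _) _)
        (dvd_mul_of_dvd_right (dvd_pow hPα two_ne_zero) _)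
    have h2 := dvd_sub hPF h1
    have e : R.c * a * (s : ℤ) ^ 2 + R.b * α * s + R.a / a * α ^ 2 - (R.b * α * s + R.a / a * α ^ 2) =
        R.c * a * (s : ℤ) ^ 2 := by ring
    rwa [e] at h2
  -- `p ∤ s`
  have hps : Nat.Coprime (p ^ (w + 1)) (s ^ 2) := by
    apply Nat.Coprime.pow
    rw [Nat.Prime.coprime_iff_not_dvd hpp]
    intro hps
    have := Nat.dvd_gcd hps (dvd_trans (dvd_pow_self p (by omega)) hpn)
    rw [hs] at this
    exact hpp.one_lt.ne' (Nat.dvd_one.1 this)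
  have hcop : IsCoprime P ((s : ℤ) ^ 2) := by
    rw [Int.isCoprime_iff_gcd_eq_one, hP]
    have : Int.gcd ((p ^ (w + 1) : ℕ) : ℤ) (((s ^ 2 : ℕ)) : ℤ) = 1 := by
      rw [Int.gcd_natCast_natCast]; exact hps
    push_cast at this
    exact this
  have hPca : P ∣ R.c * a := hcop.dvd_of_dvd_mul_right hPc
  rw [hm, ← Int.natCast_dvd, ← hP]
  exact hPca

/-- The resultant identity `4(Ca)·F_α − (2(Ca)X + Bα)·F_α' = 4(Ca)(A/a)α² − (Bα)²`. [folklore] -/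
theorem colPoly_resultant (R : BinQF) (a α : ℤ) :
    colPoly R a α * C (4 * (R.c * a)) + derivative (colPoly R a α) * (-(C (2 * (R.c * a)) * X + C (R.b * α))) =
      C (4 * (R.c * a) * (R.a / a * α ^ 2) - (R.b * α) ^ 2) := by
  have hder : derivative (colPoly R a α) = C (2 * (R.c * a)) * X + C (R.b * α) := by
    simp only [colPoly, derivative_add, derivative_mul, derivative_C, zero_mul, derivative_X_pow,
      derivative_X, zero_add, mul_one, map_mul, Nat.cast_ofNat, map_ofNat]
    norm_num
    ring
  rw [hder, colPoly]
  simp only [map_mul, map_sub, map_pow, map_ofNat]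
  ring

/-- With `a ∣ A`: `4(Ca)(A/a)α² − (Bα)² = −α²Δ`. [folklore] -/
theorem colPoly_resultant_eq (hlev : a ∣ R.a) (α : ℤ) :
    4 * (R.c * a) * (R.a / a * α ^ 2) - (R.b * α) ^ 2 = -(α ^ 2 * R.disc) := by
  rw [BinQF.disc]
  have h := Int.ediv_mul_cancel hlev
  linear_combination (4 * R.c * α ^ 2) * h

/-- `∏_{p ∈ S} p^{v_p(m)} ≤ m` for a set `S` of primes. [folklore] -/
theorem prod_pow_factorization_le {S : Finset ℕ} (hS : ∀ p ∈ S, p.Prime) {m : ℕ} (hm : m ≠ 0) :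
    ∏ p ∈ S, p ^ m.factorization p ≤ m := by
  have h1 : ∏ p ∈ S, p ^ m.factorization p = ∏ p ∈ S ∩ m.primeFactors, p ^ m.factorization p := by
    rw [← Finset.prod_filter_of_ne (p := fun p => p ∈ m.primeFactors)]
    · rfl
    · intro p hpS hne
      by_contra H
      apply hne
      rw [Nat.factorization_eq_zero_of_not_dvd]
      · simp
      · intro hpm; exact H (Nat.mem_primeFactors.2 ⟨hS p hpS, hpm, hm⟩)
  rw [h1]
  refine Nat.le_of_dvd (Nat.pos_of_ne_zero hm) ?_
  conv_rhs => rw [← Nat.prod_factorization_pow_eq_self hm]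
  rw [Finsupp.prod, Nat.support_factorization]
  exact Finset.prod_dvd_prod_of_subset _ _ _ Finset.inter_subset_right

/-- **Uniform root count for non-empty columns**: if `(n, d) ∣ Ca` then
`ρ_{F_α}(d) ≤ 2^{ω(d)} · (Ca)⁴ Δ²` — at each `p ∣ d` either `v_p(d) ≤ v_p(Ca)` (trivial bound) or
`v_p(α) ≤ v_p(Ca)`, when the resultant `−α²Δ` of `F_α, F_α'` has bounded `p`-part and the tree's
Hensel/Nagell bound applies. [cite: HardyWright2008, Thm 122–123 (§8.2–8.3)] -/
theorem rho_colPoly_le (ha : a ≠ 0) (hlev : a ∣ R.a) (hc : R.c ≠ 0) (hΔ : R.disc ≠ 0) {α : ℤ}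
    (hn : α.natAbs = n) {d : ℕ} (hd : d ≠ 0) (hgm : Nat.gcd n d ∣ (R.c * a).natAbs) :
    polyRootCountMod ![colPoly R a α] d ≤
      2 ^ d.primeFactors.card * ((R.c * a).natAbs ^ 4 * R.disc.natAbs ^ 2) := by
  set m := (R.c * a).natAbs with hm
  set Δ' := R.disc.natAbs with hΔ'
  have hm0 : m ≠ 0 := Int.natAbs_ne_zero.2 (mul_ne_zero hc ha)
  have hΔ0 : Δ' ≠ 0 := Int.natAbs_ne_zero.2 hΔ
  have hn0 : n ≠ 0 := NeZero.ne n
  have hα : α ≠ 0 := by rw [← Int.natAbs_ne_zero, hn]; exact hn0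
  have hg0 : Nat.gcd n d ≠ 0 := Nat.gcd_ne_zero_right hd
  have hgle : ∀ p, min (n.factorization p) (d.factorization p) ≤ m.factorization p := by
    intro p
    have h1 := (Nat.factorization_le_iff_dvd hg0 hm0).2 hgm p
    rwa [Nat.factorization_gcd hn0 hd, Finsupp.inf_apply] at h1
  -- per prime
  have key : ∀ p ∈ d.primeFactors, polyRootCountMod ![colPoly R a α] (p ^ d.factorization p) ≤
      2 * p ^ (4 * m.factorization p + 2 * Δ'.factorization p) := by
    intro p hp
    have hpp : p.Prime := Nat.prime_of_mem_primeFactors hp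
    haveI := Fact.mk hpp
    have hp1 : 1 ≤ p := hpp.one_lt.le
    have hmin : min (n.factorization p) (d.factorization p) ≤ m.factorization p := hgle p
    have htriv : ∀ e : ℕ, d.factorization p ≤ e →
        polyRootCountMod ![colPoly R a α] (p ^ d.factorization p) ≤ 2 * p ^ e := by
      intro e he
      calc polyRootCountMod ![colPoly R a α] (p ^ d.factorization p) ≤ p ^ d.factorization p :=
            polyRootCountMod_le _ _
        _ ≤ p ^ e := Nat.pow_le_pow_right hp1 he
        _ ≤ 2 * p ^ e := Nat.le_mul_of_pos_left _ two_pos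
    rcases le_or_gt (n.factorization p) (m.factorization p) with hjw | hwj
    · -- resultant route
      have hRr' : (4 * (R.c * a) * (R.a / a * α ^ 2) - (R.b * α) ^ 2 : ℤ) = -(α ^ 2 * R.disc) :=
        colPoly_resultant_eq hlev α
      have hRr0 : (4 * (R.c * a) * (R.a / a * α ^ 2) - (R.b * α) ^ 2 : ℤ) ≠ 0 := by
        rw [hRr']; exact neg_ne_zero.2 (mul_ne_zero (pow_ne_zero _ hα) hΔ)
      have hδ : padicValInt p (4 * (R.c * a) * (R.a / a * α ^ 2) - (R.b * α) ^ 2) =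
          2 * n.factorization p + Δ'.factorization p := by
        rw [padicValInt, hRr', Int.natAbs_neg, Int.natAbs_mul, Int.natAbs_pow, hn,
          padicValNat.mul (pow_ne_zero _ hn0) hΔ0, padicValNat.pow n 2,
          ← Nat.factorization_def _ hpp, ← Nat.factorization_def _ hpp]
      have hdeg : (colPoly R a α).natDegree = 2 := by
        rw [colPoly]; exact natDegree_quadratic (mul_ne_zero hc ha)
      rcases le_or_gt (2 * padicValInt p (4 * (R.c * a) * (R.a / a * α ^ 2) - (R.b * α) ^ 2) + 1)
        (d.factorization p) with hk | hk
      · have h1 := polyRootCountMod_prime_pow_le_of_resultant (p := p) hRr0 (colPoly_resultant R a α) hk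
        rw [hdeg] at h1
        refine h1.trans (Nat.mul_le_mul_left 2 (Nat.pow_le_pow_right hp1 ?_))
        rw [hδ]; omega
      · refine htriv _ ?_
        rw [hδ] at hk; omega
    · -- `v_p(d) ≤ v_p(Ca)`
      refine htriv _ ?_
      omega
  rw [polyRootCountMod_eq_prod_primeFactors _ hd]
  calc ∏ p ∈ d.primeFactors, polyRootCountMod ![colPoly R a α] (p ^ d.factorization p)
      ≤ ∏ p ∈ d.primeFactors, 2 * p ^ (4 * m.factorization p + 2 * Δ'.factorization p) :=
        Finset.prod_le_prod (fun p _ => Nat.zero_le _) key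
    _ = 2 ^ d.primeFactors.card * ((∏ p ∈ d.primeFactors, p ^ m.factorization p) ^ 4 *
          (∏ p ∈ d.primeFactors, p ^ Δ'.factorization p) ^ 2) := by
        rw [Finset.prod_mul_distrib, Finset.prod_const, ← Finset.prod_pow, ← Finset.prod_pow,
          ← Finset.prod_mul_distrib]
        congr 1
        refine Finset.prod_congr rfl fun p _ => ?_
        rw [pow_add, pow_mul, pow_mul]; ring
    _ ≤ 2 ^ d.primeFactors.card * (m ^ 4 * Δ' ^ 2) := by
        have hS : ∀ p ∈ d.primeFactors, p.Prime := fun p hp => Nat.prime_of_mem_primeFactors hp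
        gcongr
        · exact prod_pow_factorization_le hS hm0
        · exact prod_pow_factorization_le hS hΔ0

/-! ### The bound for the zero-frequency complete sum -/

/-- The constant `C_R = (Ca)⁵ Δ²` of the zero-frequency bound. [folklore] -/
def zeroConst (R : BinQF) (a : ℤ) : ℕ := (R.c * a).natAbs ^ 4 * R.disc.natAbs ^ 2 * (R.c * a).natAbs

/-- **The zero-frequency complete sums are small**: for every `α ≠ 0`,
`|S_α(h, 0)| ≤ C_R · 2^{ω(d)} · τ(|α|) |α|^{1/2} (h, α)^{1/2}` — empty columns vanish, and on the
others the level condition selects `ρ_{F_α}(d) = O_R(2^{ω(d)})` classes mod `d`, on each of which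
the sum is `(|α|, d) = O_R(1)` Kloosterman sums `S(−k, c; |α|)` bounded by Weil.
[cite: Ngo2024, §3.5 Proposition 3.18 (the frequency κ = 0, via Lemma 2.4 (2)); Iwaniec2002, §2.5 (2.25)] -/
theorem norm_colExpSum_zero_le (ha : 0 < a) (hlev : a ∣ R.a) (hc : R.c ≠ 0) (hΔ : R.disc ≠ 0)
    {d : ℕ} (hd : d ≠ 0) (h : ℤ) {α : ℤ} (hα : α ≠ 0) :
    ‖colExpSum a d R h α 0‖ ≤
      (zeroConst R a * 2 ^ d.primeFactors.card : ℕ) *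
        ((#α.natAbs.divisors : ℝ) * Real.sqrt α.natAbs * Real.sqrt (Int.gcd h α.natAbs)) := by
  classical
  obtain ⟨n, hn⟩ : ∃ n : ℕ, α.natAbs = n := ⟨_, rfl⟩
  haveI : NeZero n := ⟨by rw [← hn]; exact Int.natAbs_ne_zero.2 hα⟩
  have hn0 : n ≠ 0 := NeZero.ne n
  rw [colExpSum_zero_eq_sum_range ha, hn]
  have hRHS : 0 ≤ (zeroConst R a * 2 ^ d.primeFactors.card : ℕ) *
      ((#n.divisors : ℝ) * Real.sqrt n * Real.sqrt (Int.gcd h n)) := by positivity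
  -- `(α, a) > 1`: everything vanishes
  by_cases hcop : Nat.Coprime n a.toNat
  swap
  · rw [Finset.sum_eq_zero fun s _ => colCoef_mul_eq_zero_of_not_coprime ha d h (hn ▸ hcop) s,
      norm_zero]
    exact hRHS
  -- the unit `c₀ = ā`
  have hacast : ((a.toNat : ℕ) : ZMod n) = (a : ZMod n) := by
    have h1 : ((a.toNat : ℕ) : ℤ) = a := Int.toNat_of_nonneg ha.le
    rw [show (a : ZMod n) = (((a.toNat : ℕ) : ℤ) : ZMod n) by rw [h1], Int.cast_natCast]
  obtain ⟨u, hu⟩ : ∃ u : (ZMod n)ˣ, (u : ZMod n) = (a : ZMod n) :=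
    ⟨ZMod.unitOfCoprime a.toNat hcop.symm, by rw [ZMod.coe_unitOfCoprime, hacast]⟩
  obtain ⟨c₀, hc₀def⟩ : ∃ c₀ : ZMod n, c₀ = ((u⁻¹ : (ZMod n)ˣ) : ZMod n) := ⟨_, rfl⟩
  have hc₀ : (a : ZMod n) * c₀ = 1 := by rw [← hu, hc₀def, Units.mul_inv]
  obtain ⟨w, hwdef⟩ : ∃ w : ℕ, w = c₀.val := ⟨_, rfl⟩
  have hw : Nat.Coprime w n := by rw [hwdef, hc₀def]; exact ZMod.val_coe_unit_coprime _
  have hc₀w : c₀ = (w : ZMod n) := by rw [hwdef, ZMod.natCast_zmod_val]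
  simp_rw [colCoef_mul_eq ha hlev d h hn hcop hc₀]
  obtain ⟨c, hcdef⟩ : ∃ c : ZMod n, c = (((-(h * α.sign)) : ℤ) : ZMod n) * c₀ := ⟨_, rfl⟩
  rw [← hcdef]
  have hcw : c = (((-(h * α.sign)) * (w : ℕ) : ℤ) : ZMod n) := by
    rw [hcdef, hc₀w]; push_cast; ring
  -- empty column?
  by_cases hgm : Nat.gcd n d ∣ (R.c * a).natAbs
  swap
  · rw [Finset.sum_eq_zero, norm_zero]
    · exact hRHS
    intro s _
    by_cases hs : IsUnit ((s : ℕ) : ZMod n)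
    · rw [if_neg]
      exact not_dvd_colPoly_of_not_dvd ha.ne' hc hn hd hgm ((ZMod.isUnit_iff_coprime s n).1 hs)
    · have h0 : invPhase n c (s : ZMod n) = 0 := by unfold invPhase; rw [if_neg hs]
      rw [h0, ite_self]
  -- the generic column
  have hgcd : Int.gcd (-(h * α.sign)) n = Int.gcd h n := by
    rw [Int.gcd_eq_natAbs, Int.gcd_eq_natAbs, Int.natAbs_neg, Int.natAbs_mul,
      Int.natAbs_sign_of_ne_zero hα, mul_one]
  have hB : ∀ k, ‖ZMod.dft (invPhase n c) k‖ ≤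
      (#n.divisors : ℝ) * Real.sqrt n * Real.sqrt (Int.gcd h n) := by
    intro k
    rw [hcw, ← hgcd]
    exact norm_dft_invPhase_le hw k
  have hB0 : 0 ≤ (#n.divisors : ℝ) * Real.sqrt n * Real.sqrt (Int.gcd h n) :=
    (norm_nonneg _).trans (hB 0)
  have hshift : ∀ s₂ : ℕ, ‖∑ i : ZMod n, invPhase n c ((s₂ : ZMod n) + (d : ZMod n) * i)‖ ≤
      Nat.gcd d n * ((#n.divisors : ℝ) * Real.sqrt n * Real.sqrt (Int.gcd h n)) :=
    fun s₂ => norm_sum_shift_le hB _ d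
  have hgB0 : 0 ≤ Nat.gcd d n * ((#n.divisors : ℝ) * Real.sqrt n * Real.sqrt (Int.gcd h n)) :=
    mul_nonneg (Nat.cast_nonneg _) hB0
  refine (norm_sum_range_ite_dvd_le (colPoly R a α) d (invPhase n c) hshift).trans ?_
  have hρ := rho_colPoly_le ha.ne' hlev hc hΔ hn hd hgm
  have hm0 : 0 < (R.c * a).natAbs := Nat.pos_of_ne_zero (Int.natAbs_ne_zero.2 (mul_ne_zero hc ha.ne'))
  have hg : Nat.gcd d n ≤ (R.c * a).natAbs := by
    rw [Nat.gcd_comm]; exact Nat.le_of_dvd hm0 hgm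
  have hρ' : (polyRootCountMod ![colPoly R a α] d : ℝ) ≤
      (2 ^ d.primeFactors.card * ((R.c * a).natAbs ^ 4 * R.disc.natAbs ^ 2) : ℕ) := by
    exact_mod_cast hρ
  have hg' : (Nat.gcd d n : ℝ) ≤ (R.c * a).natAbs := by exact_mod_cast hg
  calc (polyRootCountMod ![colPoly R a α] d : ℝ) *
        (Nat.gcd d n * ((#n.divisors : ℝ) * Real.sqrt n * Real.sqrt (Int.gcd h n)))
      ≤ (2 ^ d.primeFactors.card * ((R.c * a).natAbs ^ 4 * R.disc.natAbs ^ 2) : ℕ) *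
        ((R.c * a).natAbs * ((#n.divisors : ℝ) * Real.sqrt n * Real.sqrt (Int.gcd h n))) :=
        mul_le_mul hρ' (mul_le_mul_of_nonneg_right hg' hB0) hgB0 (Nat.cast_nonneg _)
    _ = _ := by rw [zeroConst]; push_cast; ring

end column

/-! ### The zero-frequency part of the dual sum -/

section total

open Real
open scoped FourierTransform

variable {R : BinQF} {a : ℤ}

/-- `(|α| : ℝ)` through `natAbs` (Mathlib's `Nat.cast_natAbs` followed by `Int.cast_abs`). [folklore] -/
theorem natCast_natAbs_real (α : ℤ) : ((α.natAbs : ℕ) : ℝ) = |(α : ℝ)| := by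
  rw [Nat.cast_natAbs, Int.cast_abs]

/-- **Doubling**: for `F ≥ 0` vanishing above `N`,
`∑_{α ∈ T, α ≠ 0} F(|α|) ≤ 2 ∑_{1 ≤ n ≤ N} F(n)` (each `n` has the two preimages `±n`). [folklore] -/
theorem sum_natAbs_le_two_mul_sum {T : Finset ℤ} (hT : ∀ α ∈ T, α ≠ 0) {N : ℕ} {F : ℕ → ℝ}
    (hF : ∀ n, 0 ≤ F n) (hFN : ∀ n, N < n → F n = 0) :
    ∑ α ∈ T, F α.natAbs ≤ 2 * ∑ n ∈ Finset.Icc 1 N, F n := by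
  classical
  -- drop the terms with `|α| > N`
  have h1 : ∑ α ∈ T, F α.natAbs = ∑ α ∈ T.filter (fun α => α.natAbs ≤ N), F α.natAbs := by
    rw [Finset.sum_filter]
    refine Finset.sum_congr rfl fun α _ => ?_
    split_ifs with h
    · rfl
    · exact hFN _ (not_le.1 h)
  rw [h1, ← Finset.sum_fiberwise_of_maps_to (g := fun α : ℤ => α.natAbs) (t := Finset.Icc 1 N)
    (fun α hα => by
      rw [Finset.mem_filter] at hα
      rw [Finset.mem_Icc]
      exact ⟨Nat.one_le_iff_ne_zero.2 (Int.natAbs_ne_zero.2 (hT α hα.1)), hα.2⟩),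
    Finset.mul_sum]
  refine Finset.sum_le_sum fun n _ => ?_
  have h2 : ∑ α ∈ (T.filter (fun α => α.natAbs ≤ N)).filter (fun α => α.natAbs = n), F α.natAbs =
      #((T.filter (fun α => α.natAbs ≤ N)).filter (fun α => α.natAbs = n)) * F n := by
    rw [← nsmul_eq_mul, ← Finset.sum_const]
    refine Finset.sum_congr rfl fun α hα => ?_
    rw [Finset.mem_filter] at hα
    rw [hα.2]
  rw [h2]
  refine mul_le_mul_of_nonneg_right ?_ (hF n)
  have h3 : (T.filter (fun α => α.natAbs ≤ N)).filter (fun α => α.natAbs = n) ⊆ {(n : ℤ), -(n : ℤ)} := by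
    intro α hα
    rw [Finset.mem_filter] at hα
    rw [Finset.mem_insert, Finset.mem_singleton]
    exact Int.natAbs_eq_iff.1 hα.2
  calc (#((T.filter (fun α => α.natAbs ≤ N)).filter (fun α => α.natAbs = n)) : ℝ)
      ≤ #({(n : ℤ), -(n : ℤ)} : Finset ℤ) := by exact_mod_cast Finset.card_le_card h3
    _ ≤ 2 := by exact_mod_cast Finset.card_le_two

/-- `‖𝓕F(0)‖ ≤ ∫‖F‖` for smooth compactly supported `F`. [folklore] -/
theorem norm_fourier_zero_le {F : ℝ → ℂ} (hF : ContDiff ℝ ((⊤ : ℕ∞) : WithTop ℕ∞) F)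
    (hFc : HasCompactSupport F) : ‖𝓕 F 0‖ ≤ ∫ t, ‖F t‖ := by
  have h := FriedlanderIwaniecPrimes.pow_mul_norm_fourier_le hF hFc 0 0
  rwa [pow_zero, one_mul, iteratedDeriv_zero] at h

set_option maxHeartbeats 400000 in
/-- **The zero frequency of the dual sum is `≪ x^{3/4} d^{-1/2} (xd)^ε`.**  For the data of `HD`
(`…TothColumnSum.toth2000_quadraticRoots_primeModuli_of_dualBound`): the `κ = 0` terms
`∑_{0<|α|≤A} M_α⁻¹ 𝓕(colFn(α,·))(0) S_α(h,0)` are bounded by `K x^{3/4} d^{-1/2} (xd)^ε`,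
uniformly in `0 < |h| ≤ C_h x` and `Y₁` — within the first term
`(h,d)^{1/4} x^{3/4} d^{-1/2} Y₁^{9/4} (xdY₁)^ε` of Ngo's Proposition 3.18.  (`|𝓕(colFn(α,·))(0)| ≤
2c₂√x`, the column is empty unless `|α| ≤ c₂√x`, `norm_colExpSum_zero_le`, and
`∑_{n ≤ X} τ(n)(h,n)^{1/2}n^{-1/2} ≤ 128 τ(h) X^{1/2}(1 + log X)`.)
[cite: Ngo2024, §3.5 Proposition 3.18 (frequency κ = 0)] -/
theorem exists_dualZero_bound {b c : ℤ} (ha : 0 < a) (hΔ : 0 < discrim a b c)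
    (hsq : ¬ IsSquare (discrim a b c)) (hR : IsLevelForm a b (discrim a b c) a.toNat R) (hRa : R.a ≠ 0)
    {g₁ : SL(2, ℤ)} (hg₁ : g₁ ∈ stabLevel R a.toNat) (hκ : deckFactor R g₁ < 1) {ε : ℝ} (hε : 0 < ε)
    {Ch : ℝ} (hCh : 0 < Ch) :
    ∃ K : ℝ, 0 ≤ K ∧ ∀ x Y₁ : ℝ, 2 ≤ Y₁ → Y₁ ≤ x → ∀ d : ℕ, 1 ≤ d →
      ∀ h : ℤ, h ≠ 0 → |(h : ℝ)| ≤ Ch * x → ∀ A : ℤ,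
        ‖∑ α ∈ (Finset.Icc (-A) A).erase 0, (((α.natAbs * (a.toNat * d) : ℕ) : ℂ))⁻¹ *
            (𝓕 (fun t => colFn R a b x Y₁ h (Real.log (deckFactor R g₁)⁻¹) (tothShift R g₁) α t) 0 *
              colExpSum a d R h α 0)‖ ≤
          K * x ^ (3 / 4 : ℝ) * (d : ℝ) ^ (-(1 / 2) : ℝ) * (x * d) ^ ε := by
  classical
  -- data of the form
  have hΔR : 0 < R.disc := by rw [hR.disc_eq]; exact hΔ
  have hsqR : ¬ IsSquare R.disc := by rw [hR.disc_eq]; exact hsq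
  have hcR : R.c ≠ 0 := c_ne_zero_of_not_isSquare hsqR
  have hlev : a ∣ R.a := by
    have h := hR.level_dvd
    rwa [Int.toNat_of_nonneg ha.le] at h
  have hκ0 : 0 < deckFactor R g₁ := deckFactor_pos hRa hΔR.le hg₁.1
  have hL : 0 < Real.log (deckFactor R g₁)⁻¹ := Real.log_pos ((one_lt_inv₀ hκ0).2 hκ)
  obtain ⟨c₁, c₂, hc₁, hc₁₂, hc⟩ :=
    exists_colFn_support_consts hRa hΔR ha hL (tothShift R g₁)
  have hc₂ : 0 < c₂ := hc₁.trans_le hc₁₂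
  -- divisor bounds with exponent `δ = ε/2`
  set δ : ℝ := ε / 2 with hδ
  have hδ0 : 0 < δ := by positivity
  obtain ⟨Cτ, hCτ1, hτ⟩ := exists_card_divisors_le_mul_rpow hδ0
  have hCτ0 : 0 ≤ Cτ := zero_le_one.trans hCτ1
  -- the constant
  set C₁ : ℝ := (zeroConst R a : ℝ) with hC₁
  have hC₁0 : 0 ≤ C₁ := Nat.cast_nonneg _
  have ha' : (0 : ℝ) < (a.toNat : ℝ) := by
    have : 0 < a.toNat := by omega
    exact_mod_cast this
  refine ⟨2 * c₂ * C₁ * Cτ * (256 * (Cτ * Ch ^ δ) * Real.sqrt (1 + c₂) *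
      ((1 + 1 / δ) * (1 + c₂) ^ δ)) / a.toNat, by positivity, ?_⟩
  intro x Y₁ hY hYx d hd h hh hhx A
  have hx1 : 1 ≤ x := by linarith
  have hx0 : 0 < x := by linarith
  have hsx1 : 1 ≤ Real.sqrt x := by rw [show (1 : ℝ) = Real.sqrt 1 from Real.sqrt_one.symm]; exact Real.sqrt_le_sqrt hx1
  have hsx0 : 0 < Real.sqrt x := Real.sqrt_pos.2 hx0
  have hd0 : (0 : ℝ) < d := by exact_mod_cast hd
  have hd1 : (1 : ℝ) ≤ d := by exact_mod_cast hd
  have hdne : d ≠ 0 := by omega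
  set X : ℝ := max 1 (c₂ * Real.sqrt x) with hXdef
  have hX1 : 1 ≤ X := le_max_left _ _
  have hX0 : 0 < X := by linarith
  set N : ℕ := ⌊X⌋₊ with hNdef
  set hN : ℕ := h.natAbs with hhN
  have hhN0 : hN ≠ 0 := Int.natAbs_ne_zero.2 hh
  -- the per-column weight
  set F : ℕ → ℝ := fun n => (if (n : ℝ) ≤ c₂ * Real.sqrt x then (1 : ℝ) else 0) *
    ((#n.divisors : ℝ) * Real.sqrt (Nat.gcd hN n) / Real.sqrt n) with hFdef
  have hF0 : ∀ n, 0 ≤ F n := fun n => by rw [hFdef]; positivity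
  have hFN : ∀ n, N < n → F n = 0 := by
    intro n hn
    rw [hFdef]
    simp only
    rw [if_neg, zero_mul]
    intro hle
    have : n ≤ N := by
      rw [hNdef]; apply Nat.le_floor; exact hle.trans (le_max_right _ _)
    omega
  set B : ℝ := 2 * c₂ * Real.sqrt x * (C₁ * 2 ^ d.primeFactors.card) / ((a.toNat : ℝ) * d) with hBdef
  have hB0 : 0 ≤ B := by rw [hBdef]; positivity
  -- termwise bound
  have hterm : ∀ α ∈ (Finset.Icc (-A) A).erase 0,
      ‖(((α.natAbs * (a.toNat * d) : ℕ) : ℂ))⁻¹ *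
          (𝓕 (fun t => colFn R a b x Y₁ h (Real.log (deckFactor R g₁)⁻¹) (tothShift R g₁) α t) 0 *
            colExpSum a d R h α 0)‖ ≤ B * F α.natAbs := by
    intro α hα
    have hα0 : α ≠ 0 := Finset.ne_of_mem_erase hα
    set n := α.natAbs with hndef
    have hn0 : 0 < n := Int.natAbs_pos.2 hα0
    have hn0' : (0 : ℝ) < n := by exact_mod_cast hn0
    have hM0 : (0 : ℝ) < ((n * (a.toNat * d) : ℕ) : ℝ) := by push_cast; positivity
    -- `‖𝓕 F_α (0)‖ ≤ [n ≤ c₂√x] · 2c₂√x`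
    have hFT : ‖𝓕 (fun t => colFn R a b x Y₁ h (Real.log (deckFactor R g₁)⁻¹) (tothShift R g₁) α t) 0‖ ≤
        (if (n : ℝ) ≤ c₂ * Real.sqrt x then (1 : ℝ) else 0) * (2 * c₂ * Real.sqrt x) := by
      refine (norm_fourier_zero_le (contDiff_colFn_col hRa hΔR ha b hx0 hY h hL _ hα0)
        (hasCompactSupport_colFn hRa hΔR ha b hx0 hY h hL _ _)).trans ?_
      have hsupp : (Function.support fun t =>
          colFn R a b x Y₁ h (Real.log (deckFactor R g₁)⁻¹) (tothShift R g₁) α t) ⊆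
          Set.Icc (-(c₂ * Real.sqrt x)) (c₂ * Real.sqrt x) := by
        intro t ht
        rw [Function.mem_support] at ht
        obtain ⟨-, -, htb, -⟩ := hc b x Y₁ h α t hx0 hY ht
        exact Set.mem_Icc.2 (abs_le.1 htb)
      have hM : ∀ t, ‖colFn R a b x Y₁ h (Real.log (deckFactor R g₁)⁻¹) (tothShift R g₁) α t‖ ≤
          (if (n : ℝ) ≤ c₂ * Real.sqrt x then (1 : ℝ) else 0) := by
        intro t
        split_ifs with hle
        · exact norm_colFn_le_one _ _ _ _ _ _ _ _ _ _
        · rw [norm_le_zero_iff]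
          by_contra hne
          obtain ⟨-, -, -, hub⟩ := hc b x Y₁ h α t hx0 hY hne
          apply hle
          have : |(α : ℝ)| = n := by rw [hndef, natCast_natAbs_real]
          rw [← this]; exact hub
      refine (integral_norm_le_of_support_subset (by linarith [mul_pos hc₂ hsx0]) hsupp hM).trans ?_
      apply le_of_eq; ring
    have hS := norm_colExpSum_zero_le (R := R) ha hlev hcR hΔR.ne' hdne h hα0
    rw [norm_mul, norm_mul, norm_inv, Complex.norm_natCast]
    calc ((n * (a.toNat * d) : ℕ) : ℝ)⁻¹ *
          (‖𝓕 (fun t => colFn R a b x Y₁ h (Real.log (deckFactor R g₁)⁻¹) (tothShift R g₁) α t) 0‖ *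
            ‖colExpSum a d R h α 0‖)
        ≤ ((n * (a.toNat * d) : ℕ) : ℝ)⁻¹ *
          (((if (n : ℝ) ≤ c₂ * Real.sqrt x then (1 : ℝ) else 0) * (2 * c₂ * Real.sqrt x)) *
            ((zeroConst R a * 2 ^ d.primeFactors.card : ℕ) *
              ((#n.divisors : ℝ) * Real.sqrt n * Real.sqrt (Int.gcd h n)))) := by
          refine mul_le_mul_of_nonneg_left (mul_le_mul hFT hS (norm_nonneg _) (by positivity))
            (inv_nonneg.2 hM0.le)
      _ = B * F n := by
          rw [hBdef, hFdef, hC₁]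
          simp only
          have hgcd : (Int.gcd h n : ℝ) = Nat.gcd hN n := by
            rw [hhN, Int.gcd_eq_natAbs, Int.natAbs_natCast]
          rw [hgcd]
          have hsq : Real.sqrt n * Real.sqrt n = n := Real.mul_self_sqrt hn0'.le
          have hsn0 : Real.sqrt n ≠ 0 := (Real.sqrt_pos.2 hn0').ne'
          have had0 : (a.toNat : ℝ) * d ≠ 0 := by positivity
          push_cast
          generalize Real.sqrt (n : ℝ) = r at hsq hsn0 ⊢
          rw [← hsq]
          field_simp
  -- sum the termwise bounds
  have hsum : ∑ α ∈ (Finset.Icc (-A) A).erase 0, B * F α.natAbs ≤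
      B * (2 * (128 * ((#hN.divisors : ℝ)) * Real.sqrt X * (1 + Real.log X))) := by
    rw [← Finset.mul_sum]
    refine mul_le_mul_of_nonneg_left ?_ hB0
    refine (sum_natAbs_le_two_mul_sum (fun α hα => Finset.ne_of_mem_erase hα) hF0 hFN).trans ?_
    refine mul_le_mul_of_nonneg_left ?_ (by norm_num)
    have h1 : ∑ n ∈ Finset.Icc 1 N, F n ≤
        ∑ n ∈ (Finset.Icc 1 N).filter (fun n => 1 ∣ n),
          (#n.divisors : ℝ) * Real.sqrt (Nat.gcd hN n) / Real.sqrt n := by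
      rw [Finset.filter_true_of_mem (fun n _ => one_dvd n)]
      refine Finset.sum_le_sum fun n _ => ?_
      rw [hFdef]
      simp only
      split_ifs
      · rw [one_mul]
      · rw [zero_mul]; positivity
    refine h1.trans ?_
    have h2 := DFI1995.sum_tau_sqrt_gcd_div_sqrt_le (h := hN) (q := 1) hhN0 one_ne_zero hX1
    rw [hNdef]
    refine h2.trans (le_of_eq ?_)
    rw [Nat.gcd_one_right, mul_one, Nat.cast_one, Real.sqrt_one, div_one]
    ring
  -- assemble
  refine ((norm_sum_le _ _).trans ((Finset.sum_le_sum hterm).trans hsum)).trans ?_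
  -- `2^{ω(d)} ≤ τ(d) ≤ Cτ d^δ`, `τ(|h|) ≤ Cτ (Ch x)^δ`, `√X ≤ √(1+c₂) x^{1/4}`,
  -- `1 + log X ≤ (1 + 1/δ)(1+c₂)^δ x^{δ/2}`
  have hω : (2 : ℝ) ^ d.primeFactors.card ≤ Cτ * (d : ℝ) ^ δ := by
    have h1 : ((2 ^ d.primeFactors.card : ℕ) : ℝ) ≤ #d.divisors := by
      exact_mod_cast GoldbachSeries.two_pow_card_primeFactors_le_card_divisors hdne
    push_cast at h1
    exact h1.trans (hτ d hdne)
  have hτh : (#hN.divisors : ℝ) ≤ Cτ * Ch ^ δ * x ^ δ := by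
    refine (hτ hN hhN0).trans ?_
    rw [mul_assoc]
    refine mul_le_mul_of_nonneg_left ?_ hCτ0
    rw [← Real.mul_rpow hCh.le hx0.le]
    refine Real.rpow_le_rpow (Nat.cast_nonneg _) ?_ hδ0.le
    have : ((hN : ℕ) : ℝ) = |(h : ℝ)| := by rw [hhN, natCast_natAbs_real]
    rw [this]; exact hhx
  have hXle : X ≤ (1 + c₂) * Real.sqrt x := by
    rw [hXdef]
    apply max_le
    · nlinarith
    · nlinarith
  have hsX : Real.sqrt X ≤ Real.sqrt (1 + c₂) * x ^ (1 / 4 : ℝ) := by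
    calc Real.sqrt X ≤ Real.sqrt ((1 + c₂) * Real.sqrt x) := Real.sqrt_le_sqrt hXle
      _ = Real.sqrt (1 + c₂) * x ^ (1 / 4 : ℝ) := by
          rw [Real.sqrt_mul (by linarith)]
          congr 1
          rw [Real.sqrt_eq_rpow (Real.sqrt x), Real.sqrt_eq_rpow x, ← Real.rpow_mul hx0.le]
          norm_num
  have hlogX : 1 + Real.log X ≤ (1 + 1 / δ) * (1 + c₂) ^ δ * x ^ (δ / 2) := by
    have h1 : Real.log X ≤ X ^ δ / δ := Real.log_le_rpow_div hX0.le hδ0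
    have hXδ1 : 1 ≤ X ^ δ := Real.one_le_rpow hX1 hδ0.le
    have hXδ : X ^ δ ≤ (1 + c₂) ^ δ * x ^ (δ / 2) := by
      calc X ^ δ ≤ ((1 + c₂) * Real.sqrt x) ^ δ := Real.rpow_le_rpow hX0.le hXle hδ0.le
        _ = (1 + c₂) ^ δ * x ^ (δ / 2) := by
            rw [Real.mul_rpow (by linarith) hsx0.le, Real.sqrt_eq_rpow, ← Real.rpow_mul hx0.le]
            congr 1; congr 1; ring
    calc 1 + Real.log X ≤ X ^ δ + X ^ δ / δ := add_le_add hXδ1 h1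
      _ = (1 + 1 / δ) * X ^ δ := by ring
      _ ≤ (1 + 1 / δ) * ((1 + c₂) ^ δ * x ^ (δ / 2)) :=
          mul_le_mul_of_nonneg_left hXδ (by positivity)
      _ = _ := by ring
  -- the product of the bounds
  have hprod : B * (2 * (128 * (#hN.divisors : ℝ) * Real.sqrt X * (1 + Real.log X))) ≤
      (2 * c₂ * Real.sqrt x * (C₁ * (Cτ * (d : ℝ) ^ δ)) / ((a.toNat : ℝ) * d)) *
        (2 * (128 * (Cτ * Ch ^ δ * x ^ δ) * (Real.sqrt (1 + c₂) * x ^ (1 / 4 : ℝ)) *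
          ((1 + 1 / δ) * (1 + c₂) ^ δ * x ^ (δ / 2)))) := by
    have hB' : B ≤ 2 * c₂ * Real.sqrt x * (C₁ * (Cτ * (d : ℝ) ^ δ)) / ((a.toNat : ℝ) * d) := by
      rw [hBdef]
      refine div_le_div_of_nonneg_right ?_ (by positivity)
      refine mul_le_mul_of_nonneg_left (mul_le_mul_of_nonneg_left hω hC₁0) (by positivity)
    have hlog0 : 0 ≤ 1 + Real.log X := by linarith [Real.log_nonneg hX1]
    refine mul_le_mul hB' ?_ (by positivity) (by positivity)
    refine mul_le_mul_of_nonneg_left ?_ (by norm_num)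
    refine mul_le_mul (mul_le_mul (mul_le_mul_of_nonneg_left hτh (by norm_num)) hsX
      (Real.sqrt_nonneg _) (by positivity)) hlogX hlog0 (by positivity)
  refine hprod.trans ?_
  -- compare the powers: `√x · x^δ · x^{1/4} · x^{δ/2} ≤ x^{3/4} x^ε`, `d^δ / d ≤ d^{-1/2} d^ε`
  have hxpow : Real.sqrt x * x ^ δ * x ^ (1 / 4 : ℝ) * x ^ (δ / 2) ≤ x ^ (3 / 4 : ℝ) * x ^ ε := by
    rw [Real.sqrt_eq_rpow, ← Real.rpow_add hx0, ← Real.rpow_add hx0, ← Real.rpow_add hx0,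
      ← Real.rpow_add hx0]
    refine Real.rpow_le_rpow_of_exponent_le hx1 ?_
    rw [hδ]; linarith
  have hdpow : (d : ℝ) ^ δ / d ≤ (d : ℝ) ^ (-(1 / 2) : ℝ) * (d : ℝ) ^ ε := by
    rw [div_eq_mul_inv, ← Real.rpow_neg_one, ← Real.rpow_add hd0, ← Real.rpow_add hd0]
    refine Real.rpow_le_rpow_of_exponent_le hd1 ?_
    rw [hδ]; linarith
  have hxd : (x * d) ^ ε = x ^ ε * (d : ℝ) ^ ε := Real.mul_rpow hx0.le hd0.le
  rw [hxd]
  -- rearrange both sides as (constant) · (x-powers) · (d-powers)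
  have hlhs : (2 * c₂ * Real.sqrt x * (C₁ * (Cτ * (d : ℝ) ^ δ)) / ((a.toNat : ℝ) * d)) *
        (2 * (128 * (Cτ * Ch ^ δ * x ^ δ) * (Real.sqrt (1 + c₂) * x ^ (1 / 4 : ℝ)) *
          ((1 + 1 / δ) * (1 + c₂) ^ δ * x ^ (δ / 2)))) =
      (2 * c₂ * C₁ * Cτ * (256 * (Cτ * Ch ^ δ) * Real.sqrt (1 + c₂) * ((1 + 1 / δ) * (1 + c₂) ^ δ)) /
          a.toNat) *
        (Real.sqrt x * x ^ δ * x ^ (1 / 4 : ℝ) * x ^ (δ / 2)) * ((d : ℝ) ^ δ / d) := by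
    ring
  rw [hlhs]
  have hK0 : 0 ≤ 2 * c₂ * C₁ * Cτ * (256 * (Cτ * Ch ^ δ) * Real.sqrt (1 + c₂) *
      ((1 + 1 / δ) * (1 + c₂) ^ δ)) / a.toNat := by positivity
  calc (2 * c₂ * C₁ * Cτ * (256 * (Cτ * Ch ^ δ) * Real.sqrt (1 + c₂) * ((1 + 1 / δ) * (1 + c₂) ^ δ)) /
          a.toNat) *
        (Real.sqrt x * x ^ δ * x ^ (1 / 4 : ℝ) * x ^ (δ / 2)) * ((d : ℝ) ^ δ / d)
      ≤ (2 * c₂ * C₁ * Cτ * (256 * (Cτ * Ch ^ δ) * Real.sqrt (1 + c₂) * ((1 + 1 / δ) * (1 + c₂) ^ δ)) /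
          a.toNat) *
        (x ^ (3 / 4 : ℝ) * x ^ ε) * ((d : ℝ) ^ (-(1 / 2) : ℝ) * (d : ℝ) ^ ε) := by
        refine mul_le_mul (mul_le_mul_of_nonneg_left hxpow hK0) hdpow (by positivity) (by positivity)
    _ = _ := by ring

end total

end RootForms

end Literature.NumberTheory.Sieve
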